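import Literature.Analysis.FluidPDE.SelfSimilarLiouvilleSwirlSupProofs
import Literature.Analysis.FluidPDE.ParabolicLocalEstimatesProofs
import HarnessLib

/-!
# Lei–Zhang–Zhao 2017, Theorem 1.3: the Liouville theorem for axisymmetric ancient solutions
# with `Γ = r v_θ ∈ L^∞_t L^p_x` — discharge of `leiZhangZhao2017_liouville_swirl_Lp`

Analysis/FluidPDE proof file (theorems only: no definitions, no named facts, no `sorry`)
discharging the named fact `Literature.Analysis.FluidPDE.leiZhangZhao2017_liouville_swirl_Lp` of
`SelfSimilarLiouville.lean` (Z. Lei, Q. S. Zhang, N. Zhao, *Improved Liouville theorems for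
axially symmetric Navier–Stokes equations*, arXiv:1701.00868 = Sci. Sin. Math. 47 (2017),
**Theorem 1.3**, arXiv p. 4: "Let `v` be a bounded ancient mild solution of the 3D axially
symmetric Navier–Stokes equations with `v_θ ≠ 0` and let `Γ = r v_θ`. If
`Γ ∈ L^∞_t L^p_x(ℝ³ × (−∞, 0))` where `1 ≤ p < ∞`, then `v` must be a constant"):

* `leiZhangZhao2017_liouville_swirl_Lp_holds : leiZhangZhao2017_liouville_swirl_Lp`.

## The printed proof (§5, arXiv pp. 10–12) and its rendering here

Print splits Theorem 1.3 into **Lemma 5.1** (`Γ ∈ L^∞_t L^p_x` ⇒ `lim_{r→∞} Γ = 0` uniformly in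
`z, t`: Step 1, Moser's iteration for `∂ₜΓ + b·∇Γ + (2/r)∂ᵣΓ − ΔΓ = 0` giving the mean value
inequality `sup_{Q_{1/2}} |Γ| ≤ C‖Γ‖_{L^p(Q_1)}`; Step 2, axisymmetry and `[r]` disjoint unit balls
on a circle giving `‖Γ‖_{L^p(B_1(x₀))} ≤ C r^{-1/p}`) and **Lemma 5.2** (`Γ ≡ 0` by the strong
maximum principle off the axis — Case 1, `sup Γ` attained; Case 2, `sup Γ` approached along a
translated sequence, compactness by KNSS 2009, Lemma 6.1 — using `Γ = 0` on the axis; then "according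
to Theorem 5.2 in [KNSS], `v` must be a constant"). The tree already holds, **proved**, every deep
input of this scheme, and the file follows the printed architecture with two substitutions, each
replacing a printed tool by the corresponding theorem of the tree:

1. **§4 regularity and the swirl equation** for the axisymmetric representative `U` of a bounded
   weak solution, `u = U + β(t) e_z` a.e. (`KNSS2009_regularity_axisymmetric_swirl_holds`,
   `KNSSThm53OfWindow`): `Γ = swirl U` solves (5.10) = LZZ's (5.2) off the axis in the
   elementary time-integrated class, with `∇Γ`, `ΔΓ` jointly continuous (swirl calculus of
   `SwirlTransportProofs`, exactly as in the tree's `KNSS2009_thm53_ae_swirl_free`). The term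
   `(2/r)∂ᵣΓ` is merged into the drift, `a = U + βe_z + (2/r)e_r`, bounded on every `{r ≥ ρ}`,
   so that away from the axis `Γ` solves `Γₜ + a·∇Γ − ΔΓ = 0` with bounded measurable drift — an
   equation invariant under *all* space–time translations (`driftHeat_translate_data`).
2. **Lemma 5.1, Step 1** (mean value inequality): instead of re-running Moser's iteration we use
   the local maximum principle, Lieberman 1996, Thm 6.17, proved in the tree
   (`Lieberman1996_local_max_holds`, `ParabolicLocalEstimatesProofs`), on cylinders
   `B(y, 2) × (t − 4, t)` away from the axis, for `±Γ`; with Tonelli and Hölder,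
   `∫_Q Γ⁺ ≤ 4|B₂|^{1−1/p} K`, whence `Γ` is bounded (`driftHeat_bounded_of_eLpNorm_le`; near the
   axis `|Γ| ≤ r‖U‖_∞`). Step 2 of Lemma 5.1 (the decay) is not needed in this rendering.
3. **Lemma 5.2** (`Γ ≡ 0`): instead of the compactness argument (KNSS's Lemma 6.1 and the strong
   maximum principle for the limit) we use KNSS's own *stability* form of the strong maximum
   principle, Lemma 2.1, proved in the tree (`KNSS2009_lemma21_holds`, `KNSSLemma21Proof`) — the
   tool with which KNSS prove their Theorem 5.3: if `M = sup|Γ| > 0`, a near-maximum point lies at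
   distance `≥ 2ρ₀ = M/(2‖U‖_∞)` from the axis (print: "`Γ|_{r=0} = 0`"); translated to the centre
   of a thin cylinder `{r < ρ₀, |z| < L+2}`, Lemma 2.1 makes `|Γ| ≥ M/2` on a block
   `x₁ + {r ≤ ρ₀/2, |z| ≤ L}` of volume `2L|B̄_{ρ₀/2}(ℝ²)|` during a unit time interval, which
   contradicts `‖Γ(t)‖_p ≤ K` at a.e. time for `L` large (`driftHeat_eq_zero_of_eLpNorm_le`).
4. **KNSS's Theorem 5.2**, proved in the tree (`KNSS2009_liouville_axisymmetric_no_swirl_holds`),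
   concludes in the printed class (`leiZhangZhao2017_liouville_swirl_Lp_boundedWeak`), and the
   tree's bridge from the slice-wise duality-form class to the printed class — the bounded weak,
   a.e. axisymmetric modification `v(t) = u(t) + d(t) e_z` a.e. of
   `exists_boundedWeak_axisymmetric_modification` (`SelfSimilarLiouvilleSwirlSupProofs`, the
   packaged steps (1)–(4) of `knss_axisymmetric_no_swirl_of_KNSS2009`), whose swirl has the same
   `L^p` norms since the swirl does not see axial shifts (`swirl_add_smul_eZ`), followed by the
   upgrade from a.e. `t` to every `t < 0` (`IsBoundedAncientMildSolution.exists_ae_eq_const_slice`)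
   and the axiality of the constant (`eq_smul_eZ_of_ae_eq_const_of_isAxisymmetric`) — gives the
   fact as stated (`leiZhangZhao2017_liouville_swirl_Lp_holds`).

Mathlib / tree search (`lean search`): no prior `leiZhangZhao2017_liouville_swirl_Lp_holds`,
`driftHeat_`, `_boundedWeak` for this theorem; the sibling `SelfSimilarLiouvilleSwirlDecayProofs`
(Remark 1.4, radial decay) runs the analogous Lemma 2.1 argument on annular cylinders with axial
translations only, which does not apply here (no decay is available before Lemma 5.1, and the
thin-cylinder argument needs full translations with the merged drift), so its
`swirlDecay_translate_lemma21_data` is not reused; its name `leiZhangZhao2017_ae_swirl_free` is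
avoided (`leiZhangZhao2017_Lp_ae_swirl_free`).

## References

* Z. Lei, Q. S. Zhang, N. Zhao, *Improved Liouville theorems for axially symmetric Navier–Stokes
  equations*, arXiv:1701.00868 = Sci. Sin. Math. 47 (2017) 1183–1198,
  doi:10.1360/N012016-00149: Theorem 1.3 and Remark 1.4 (arXiv p. 4), §5, Lemma 5.1 (pp. 10–11,
  (5.1)–(5.12)) and Lemma 5.2 (pp. 11–12). [LeiZhangZhao2017]
* G. Koch, N. Nadirashvili, G. Seregin, V. Šverák, *Liouville theorems for the Navier–Stokes
  equations and applications*, Acta Math. 203 (2009) 83–105 = arXiv:0709.3599: Lemma 2.1 (p. 5),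
  §4 (p. 8), Theorem 5.2 and (5.10) (pp. 9–10). [KochNadirashviliSereginSverak2009]
* G. M. Lieberman, *Second Order Parabolic Differential Equations*, World Scientific (1996),
  Ch. VI, Theorem 6.17 (local maximum principle). [Lieberman1996]
-/

noncomputable section

open MeasureTheory Set Function Filter Topology TopologicalSpace InnerProductSpace Metric
open scoped Laplacian RealInnerProductSpace ContDiff NNReal ENNReal

namespace Literature.Analysis.FluidPDE

/-! ### Elementary geometry of the distance to the axis -/

/-- `r(x₀) − r(y) ≤ r(x₀ + y)`. [folklore] -/
theorem cylRadius_sub_le_cylRadius_add (x₀ y : (EuclideanSpace ℝ (Fin 3))) : cylRadius x₀ - cylRadius y ≤ cylRadius (x₀ + y) := by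
  have h := SereginSverak2009.cylRadius_le_cylRadius_add x₀ (x₀ + y)
  have h2 : cylRadius (x₀ - (x₀ + y)) = cylRadius y := by
    rw [show x₀ - (x₀ + y) = -y by abel, SereginSverak2009.cylRadius_neg]
  linarith

/-! ### Translation covariance of the elementary drift–heat class -/

/-- **Translations of the elementary solution class of `uₜ + a·∇u − Δu = 0`.** Let `g` have `C²`
slices for `t < 0` with `∇g`, `Δg` jointly continuous on `(−∞, 0) × ℝ³`, let the drift `a` be
jointly measurable with `‖a‖ ≤ A` on `{r ≥ ρ}`, and let the time-integrated equation
`g(t,x) − g(s,x) = ∫ₛᵗ (Δg − Dg[a])` hold for `r(x) ≥ ρ`, `s ≤ t < 0`. For `t₀ + T < 0`, a centre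
`x₀` and a set `Ω` with `x₀ + Ω ⊆ {r ≥ ρ}`, the translates `(s, y) ↦ g(t₀ + s, x₀ + y)`,
`(s, y) ↦ a(t₀ + s, x₀ + y)` (the tree's `stPull 1 1 t₀ x₀`) satisfy the six hypotheses of the
solution class of `KNSS2009_lemma21` / `Lieberman1996_local_max` on `(0, T] × Ω` with the drift
bound `A` (the equation has constant coefficients once `(2/r)∂ᵣ` is merged into the drift, so it
is invariant under all space–time translations). [folklore] -/
theorem driftHeat_translate_data {g : ℝ → (EuclideanSpace ℝ (Fin 3)) → ℝ} {a : ℝ → (EuclideanSpace ℝ (Fin 3)) → (EuclideanSpace ℝ (Fin 3))} {A ρ t₀ T : ℝ} {x₀ : (EuclideanSpace ℝ (Fin 3))}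
    {Ω : Set (EuclideanSpace ℝ (Fin 3))}
    (hg1 : ∀ t < 0, ContDiff ℝ 2 (g t))
    (hg2 : ContinuousOn (fun q : ℝ × (EuclideanSpace ℝ (Fin 3)) => fderiv ℝ (g q.1) q.2) (Iio 0 ×ˢ univ))
    (hg3 : ContinuousOn (fun q : ℝ × (EuclideanSpace ℝ (Fin 3)) => (Δ (g q.1)) q.2) (Iio 0 ×ˢ univ))
    (ha : Measurable (uncurry a))
    (hA : ∀ t < 0, ∀ x, ρ ≤ cylRadius x → ‖a t x‖ ≤ A)
    (heq : ∀ x, ρ ≤ cylRadius x → ∀ s t : ℝ, s ≤ t → t < 0 →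
      g t x - g s x = ∫ τ in s..t, ((Δ (g τ)) x - fderiv ℝ (g τ) x (a τ x)))
    (hT : t₀ + T < 0) (hΩ : ∀ y ∈ Ω, ρ ≤ cylRadius (x₀ + y)) :
    Measurable (uncurry (stPull 1 1 t₀ x₀ a)) ∧
    (∀ s ∈ Ioc 0 T, ∀ y ∈ Ω, ‖stPull 1 1 t₀ x₀ a s y‖ ≤ A) ∧
    (∀ s ∈ Ioc 0 T, ContDiffOn ℝ 2 (stPull 1 1 t₀ x₀ g s) Ω) ∧
    ContinuousOn (fun q : ℝ × (EuclideanSpace ℝ (Fin 3)) => fderiv ℝ (stPull 1 1 t₀ x₀ g q.1) q.2) (Ioc 0 T ×ˢ Ω) ∧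
    ContinuousOn (fun q : ℝ × (EuclideanSpace ℝ (Fin 3)) => (Δ (stPull 1 1 t₀ x₀ g q.1)) q.2) (Ioc 0 T ×ˢ Ω) ∧
    (∀ y ∈ Ω, ∀ s t : ℝ, 0 < s → s ≤ t → t ≤ T →
      stPull 1 1 t₀ x₀ g t y - stPull 1 1 t₀ x₀ g s y =
        ∫ r in s..t, ((Δ (stPull 1 1 t₀ x₀ g r)) y -
          fderiv ℝ (stPull 1 1 t₀ x₀ g r) y (stPull 1 1 t₀ x₀ a r y))) := by
  have htime : ∀ s, s ≤ T → t₀ + 1 * s < 0 := fun s hs => by linarith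
  have hΦc : Continuous fun q : ℝ × (EuclideanSpace ℝ (Fin 3)) => (t₀ + 1 * q.1, x₀ + (1 : ℝ) • q.2) := by fun_prop
  have hΦmaps : MapsTo (fun q : ℝ × (EuclideanSpace ℝ (Fin 3)) => (t₀ + 1 * q.1, x₀ + (1 : ℝ) • q.2))
      (Ioc 0 T ×ˢ Ω) (Iio 0 ×ˢ univ) := fun q hq => ⟨htime q.1 hq.1.2, mem_univ _⟩
  refine ⟨?_, ?_, ?_, ?_, ?_, ?_⟩
  · -- measurability of the translated drift
    rw [uncurry_stPull]
    exact ha.comp (measurable_stAffine 1 1 t₀ x₀)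
  · -- the drift bound
    intro s hs y hy
    simp only [stPull_apply, one_smul]
    exact hA _ (htime s hs.2) _ (hΩ y hy)
  · -- `C²` slices
    intro s hs
    have h := hg1 _ (htime s hs.2)
    exact (h.comp (contDiff_const.add (contDiff_const_smul (1 : ℝ)))).contDiffOn
  · -- `∇` of the translate
    have hc := hg2.comp hΦc.continuousOn hΦmaps
    refine hc.congr fun q _ => ?_
    simp only [comp_apply]
    rw [fderiv_stPull, one_smul]
  · -- `Δ` of the translate
    have hc := hg3.comp hΦc.continuousOn hΦmaps
    refine hc.congr fun q hq => ?_
    have h2 : ContDiff ℝ 2 (g (t₀ + 1 * q.1)) := hg1 _ (htime q.1 hq.1.2)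
    simp only [comp_apply]
    rw [laplacian_stPull 1 1 t₀ x₀ g q.1 q.2 h2, one_pow, one_smul]
  · -- the equation: substitute `τ = t₀ + σ`
    intro y hy s t hs hst htT
    have hyX : ρ ≤ cylRadius (x₀ + y) := hΩ y hy
    set G : ℝ → ℝ := fun τ => (Δ (g τ)) (x₀ + y) - fderiv ℝ (g τ) (x₀ + y) (a τ (x₀ + y)) with hG
    have hsrc : g (t₀ + t) (x₀ + y) - g (t₀ + s) (x₀ + y) = ∫ τ in (t₀ + s)..(t₀ + t), G τ :=
      heq _ hyX _ _ (by linarith) (by linarith [htime t htT])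
    have hint : EqOn (fun σ => (Δ (stPull 1 1 t₀ x₀ g σ)) y -
        fderiv ℝ (stPull 1 1 t₀ x₀ g σ) y (stPull 1 1 t₀ x₀ a σ y))
        (fun σ => G (t₀ + σ)) (uIcc s t) := by
      intro σ hσ
      rw [uIcc_of_le hst] at hσ
      have hσ' : t₀ + 1 * σ < 0 := htime σ (hσ.2.trans htT)
      have h2 : ContDiff ℝ 2 (g (t₀ + 1 * σ)) := hg1 _ hσ'
      simp only [hG]
      rw [laplacian_stPull 1 1 t₀ x₀ g σ y h2, fderiv_stPull, stPull_apply]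
      simp only [one_pow, one_smul, one_mul]
    have hlhs : stPull 1 1 t₀ x₀ g t y - stPull 1 1 t₀ x₀ g s y =
        g (t₀ + t) (x₀ + y) - g (t₀ + s) (x₀ + y) := by
      simp only [stPull_apply, one_mul, one_smul]
    rw [hlhs, hsrc, intervalIntegral.integral_congr hint, intervalIntegral.integral_comp_add_left]

/-! ### From `Γ ∈ L^∞_t L^p_x` to a uniform bound (LZZ 2017, Lemma 5.1, Step 1) -/

/-- Transfer of an a.e. property of negative times along a time translation: if `P τ` holds for
a.e. `τ < 0` and `c + b ≤ 0`, then `P (c + t)` holds for a.e. `t ∈ (a', b)`. [folklore] -/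
theorem ae_restrict_Ioo_comp_add_of_ae_restrict_Iio {P : ℝ → Prop} {c a' b : ℝ}
    (h : ∀ᵐ τ ∂((volume : Measure ℝ).restrict (Iio 0)), P τ) (hcb : c + b ≤ 0) :
    ∀ᵐ t ∂((volume : Measure ℝ).restrict (Ioo a' b)), P (c + t) := by
  rw [ae_restrict_iff' measurableSet_Iio, ae_iff] at h
  rw [ae_restrict_iff' measurableSet_Ioo, ae_iff]
  refine measure_mono_null (fun t ht => ?_)
    ((measure_preimage_add volume c {τ | ¬(τ ∈ Iio 0 → P τ)}).trans h)
  simp only [mem_setOf_eq, Classical.not_imp, mem_Ioo] at ht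
  show ¬(c + t ∈ Iio 0 → P (c + t))
  rw [mem_Iio, Classical.not_imp]
  exact ⟨by linarith [ht.1.2], ht.2⟩

/-- **The mean-value step of Lei–Zhang–Zhao 2017, Lemma 5.1** (arXiv:1701.00868, §5, Step 1,
(5.1)–(5.9): "`sup_{Q_{1/2}(x₀,t₀)} |Γ| ≤ C (∫_{Q_1(x₀,t₀)} |Γ|^p dx dt)^{1/p}`, `1 ≤ p < ∞`", there
by Moser's iteration for `∂ₜΓ + b·∇Γ + (2/r)∂ᵣΓ − ΔΓ = 0`; combined with
"`(∫_{Q_1(x₀,t₀)}|Γ|^p)^{1/p} ≤ sup_t (∫_{B_1(x₀)} |Γ(·,t)|^p)^{1/p}`" of Step 2). **Statement**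
(for the elementary solution class of the tree, away from the axis, where `(2/r)∂ᵣ` is part of a
bounded drift): let `f` have `C²` slices for `t < 0`, `f`, `∇f`, `Δf` jointly continuous on
`(−∞,0) × ℝ³`, let `a` be a jointly measurable drift with `‖a‖ ≤ A` on `{r ≥ ρ}`, let
`f(t,x) − f(s,x) = ∫ₛᵗ (Δf − Df[a])` hold for `r(x) ≥ ρ`, `s ≤ t < 0`, and let
`‖f(t,·)‖_{L^p(ℝ³)} ≤ K < ∞` for a.e. `t < 0`, `1 ≤ p`. Then `|f| ≤ C` on `(−∞,0) × {r ≥ ρ + 3}`.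
**Proof** (deviation from print: instead of re-running Moser's iteration we invoke the local
maximum principle in the form already proved in the tree, Lieberman 1996, Thm 6.17 =
`Lieberman1996_local_max_holds`, for `±f` on the cylinders `B(y,2) × (t₀ + ε − 4, t₀ + ε)`,
`ε = min(−t₀/2, 1/2)`, after a time translation; the space–time integral `∫_Q f⁺` is bounded by
`4 |B₂|^{1−1/p} K` by Tonelli and Hölder). [cite: LeiZhangZhao2017, Lemma 5.1, Step 1 (arXiv pp. 10–11)] -/
theorem driftHeat_bounded_of_eLpNorm_le {f : ℝ → (EuclideanSpace ℝ (Fin 3)) → ℝ} {a : ℝ → (EuclideanSpace ℝ (Fin 3)) → (EuclideanSpace ℝ (Fin 3))} {A ρ : ℝ}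
    {p : ℝ≥0∞} {K : ℝ≥0∞}
    (h0 : ContinuousOn (uncurry f) (Iio 0 ×ˢ univ))
    (h1 : ∀ t < 0, ContDiff ℝ 2 (f t))
    (h2 : ContinuousOn (fun q : ℝ × (EuclideanSpace ℝ (Fin 3)) => fderiv ℝ (f q.1) q.2) (Iio 0 ×ˢ univ))
    (h3 : ContinuousOn (fun q : ℝ × (EuclideanSpace ℝ (Fin 3)) => (Δ (f q.1)) q.2) (Iio 0 ×ˢ univ))
    (ha : Measurable (uncurry a))
    (hA : ∀ t < 0, ∀ x, ρ ≤ cylRadius x → ‖a t x‖ ≤ A)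
    (hp : 1 ≤ p) (hK : K ≠ ⊤)
    (hLp : ∀ᵐ t ∂((volume : Measure ℝ).restrict (Iio 0)), eLpNorm (f t) p volume ≤ K)
    (heq : ∀ x, ρ ≤ cylRadius x → ∀ s t : ℝ, s ≤ t → t < 0 →
      f t x - f s x = ∫ τ in s..t, ((Δ (f τ)) x - fderiv ℝ (f τ) x (a τ x))) :
    ∃ C : ℝ, ∀ t < 0, ∀ x, ρ + 3 ≤ cylRadius x → |f t x| ≤ C := by
  obtain ⟨C, hC0, hC⟩ :=
    Lieberman1996_local_max_holds (EuclideanSpace ℝ (Fin 3)) (A := A) (R₀ := 1) one_pos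
  -- the slice bound `B = K |B₂|^{1 - 1/p}`
  set V : ℝ≥0∞ := volume (ball (0 : (EuclideanSpace ℝ (Fin 3))) 2) with hV_def
  have hV : V ≠ ⊤ := measure_ball_lt_top.ne
  have hexp : 0 ≤ 1 - 1 / p.toReal := by
    rcases eq_or_ne p ⊤ with rfl | hpt
    · simp
    · have h1 : 1 ≤ p.toReal := by
        have := ENNReal.toReal_mono hpt hp
        simpa using this
      have : 1 / p.toReal ≤ 1 := by
        rw [div_le_one (by linarith)]
        exact h1
      linarith
  set B : ℝ≥0∞ := K * V ^ (1 - 1 / p.toReal) with hB_def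
  have hB : B ≠ ⊤ := ENNReal.mul_ne_top hK (ENNReal.rpow_ne_top_of_nonneg hexp hV)
  have h4B : 4 * B ≠ ⊤ := ENNReal.mul_ne_top (by norm_num) hB
  -- the region away from the axis
  set Ω : Set (EuclideanSpace ℝ (Fin 3)) := {x | ρ < cylRadius x} with hΩ_def
  have hΩo : IsOpen Ω := isOpen_lt continuous_const continuous_cylRadius
  -- one-sided bound for every `g` of the class with `|g| = |f|`
  have key : ∀ g : ℝ → (EuclideanSpace ℝ (Fin 3)) → ℝ, ContinuousOn (uncurry g) (Iio 0 ×ˢ univ) →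
      (∀ t < 0, ContDiff ℝ 2 (g t)) →
      ContinuousOn (fun q : ℝ × (EuclideanSpace ℝ (Fin 3)) => fderiv ℝ (g q.1) q.2) (Iio 0 ×ˢ univ) →
      ContinuousOn (fun q : ℝ × (EuclideanSpace ℝ (Fin 3)) => (Δ (g q.1)) q.2) (Iio 0 ×ˢ univ) →
      (∀ x, ρ ≤ cylRadius x → ∀ s t : ℝ, s ≤ t → t < 0 →
        g t x - g s x = ∫ τ in s..t, ((Δ (g τ)) x - fderiv ℝ (g τ) x (a τ x))) →
      (∀ t x, |g t x| = |f t x|) →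
      ∀ t₀ < 0, ∀ y, ρ + 3 ≤ cylRadius y → g t₀ y ≤ C * ((4 * B).toReal + 1) := by
    intro g hg0 hg1 hg2 hg3 hgeq habs t₀ ht₀ y hy
    -- the time shift
    set ε' : ℝ := min (-t₀ / 2) (1 / 2) with hε'_def
    have hε'0 : 0 < ε' := lt_min (by linarith) (by norm_num)
    have hε'1 : ε' ≤ 1 / 2 := min_le_right _ _
    have hε't : t₀ + ε' < 0 := by
      have : ε' ≤ -t₀ / 2 := min_le_left _ _
      linarith
    set c : ℝ := t₀ + ε' - 5 with hc_def
    have hcT : c + 5 < 0 := by rw [hc_def]; linarith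
    -- the cylinder lies in `Ω`
    have hball : closedBall y (2 * 1) ⊆ Ω := by
      intro z hz
      rw [mem_closedBall, dist_eq_norm] at hz
      have h1 := SereginSverak2009.cylRadius_le_cylRadius_add y z
      have h2 := SereginSverak2009.cylRadius_le_norm' (y - z)
      rw [← norm_neg, neg_sub] at hz
      show ρ < cylRadius z
      linarith
    -- the translated data
    obtain ⟨hm, hbd, hC2, hco1, hco2, hEq⟩ := driftHeat_translate_data (T := 5) (x₀ := (0 : (EuclideanSpace ℝ (Fin 3))))
      (Ω := Ω) hg1 hg2 hg3 ha hA hgeq hcT (fun z hz => by rw [zero_add]; exact le_of_lt hz)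
    -- the local maximum principle at `(5 - ε', y)`
    have hlm := hC hΩo hm hbd hC2 hco1 hco2 hEq (y := y) (s := 5) (R := 1) (k := 1) one_pos le_rfl
      one_pos hball (by norm_num) le_rfl (t := 5 - ε') (x := y)
      ⟨by linarith, by linarith⟩ (mem_ball_self one_pos)
    have hval : stPull 1 1 c 0 g (5 - ε') y = g t₀ y := by
      simp only [stPull_apply, one_mul, one_smul, zero_add]
      congr 1
      rw [hc_def]; ring
    rw [hval, one_pow, inv_one, one_mul, one_mul] at hlm
    -- the space–time integral of `g⁺` over the cylinder is at most `4B`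
    set S : Set (ℝ × (EuclideanSpace ℝ (Fin 3))) := Ioo (5 - (2 * 1) ^ 2) 5 ×ˢ ball y (2 * 1) with hS_def
    have hSm : MeasurableSet S := measurableSet_Ioo.prod measurableSet_ball
    -- continuity of the translate on `S`
    have hmaps : MapsTo (fun q : ℝ × (EuclideanSpace ℝ (Fin 3)) => (c + 1 * q.1, (0 : (EuclideanSpace ℝ (Fin 3))) + (1 : ℝ) • q.2)) S
        (Iio 0 ×ˢ univ) := by
      intro q hq
      refine ⟨?_, mem_univ _⟩
      show c + 1 * q.1 < 0
      have := hq.1.2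
      linarith
    have hcontu : ContinuousOn (fun q : ℝ × (EuclideanSpace ℝ (Fin 3)) => stPull 1 1 c 0 g q.1 q.2) S := by
      have h := hg0.comp (by fun_prop : Continuous fun q : ℝ × (EuclideanSpace ℝ (Fin 3)) =>
        (c + 1 * q.1, (0 : (EuclideanSpace ℝ (Fin 3))) + (1 : ℝ) • q.2)).continuousOn hmaps
      exact h
    have hI_meas : AEStronglyMeasurable (fun q : ℝ × (EuclideanSpace ℝ (Fin 3)) => max (stPull 1 1 c 0 g q.1 q.2) 0)
        (volume.restrict S) :=
      (continuous_max.comp_continuousOn (hcontu.prodMk continuousOn_const)).aestronglyMeasurable hSm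
    have hI_nn : 0 ≤ᵐ[volume.restrict S] fun q : ℝ × (EuclideanSpace ℝ (Fin 3)) => max (stPull 1 1 c 0 g q.1 q.2) 0 :=
      Eventually.of_forall fun q => le_max_right _ _
    have hI_eq := integral_eq_lintegral_of_nonneg_ae hI_nn hI_meas
    -- the good times
    have hgood : ∀ᵐ t ∂((volume : Measure ℝ).restrict (Ioo (5 - (2 * 1) ^ 2) 5)),
        eLpNorm (f (c + t)) p volume ≤ K :=
      ae_restrict_Ioo_comp_add_of_ae_restrict_Iio hLp hcT.le
    -- the slice estimate at a good time
    have hslice : ∀ t, eLpNorm (f (c + t)) p volume ≤ K → c + t < 0 →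
        ∫⁻ x in ball y (2 * 1), ‖stPull 1 1 c 0 g t x‖ₑ ≤ B := by
      intro t ht htc
      have hfun : (fun x => ‖stPull 1 1 c 0 g t x‖ₑ) = fun x => ‖f (c + t) x‖ₑ := by
        funext x
        simp only [stPull_apply, one_mul, one_smul, zero_add, Real.enorm_eq_ofReal_abs, habs]
      rw [hfun, ← eLpNorm_one_eq_lintegral_enorm]
      have hfm : AEStronglyMeasurable (f (c + t)) (volume.restrict (ball y (2 * 1))) :=
        (h1 _ htc).continuous.aestronglyMeasurable.restrict
      have hH := eLpNorm_le_eLpNorm_mul_rpow_measure_univ hp hfm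
      rw [Measure.restrict_apply_univ, ENNReal.toReal_one] at hH
      refine hH.trans ?_
      have hVy : volume (ball y (2 * 1)) = V := by
        rw [hV_def, Measure.addHaar_ball_center]; norm_num
      rw [hVy, show (1 : ℝ) / 1 - 1 / p.toReal = 1 - 1 / p.toReal by ring]
      exact mul_le_mul' ((eLpNorm_restrict_le _ _ _ _).trans ht) le_rfl
    have hlin : ∫⁻ q in S, ENNReal.ofReal (max (stPull 1 1 c 0 g q.1 q.2) 0) ≤ 4 * B := by
      calc ∫⁻ q in S, ENNReal.ofReal (max (stPull 1 1 c 0 g q.1 q.2) 0)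
          ≤ ∫⁻ q in S, ‖stPull 1 1 c 0 g q.1 q.2‖ₑ := by
            refine lintegral_mono fun q => ?_
            rw [Real.enorm_eq_ofReal_abs]
            exact ENNReal.ofReal_le_ofReal (max_le (le_abs_self _) (abs_nonneg _))
        _ = ∫⁻ q, ‖stPull 1 1 c 0 g q.1 q.2‖ₑ
              ∂((volume.restrict (Ioo (5 - (2 * 1) ^ 2) 5)).prod
                (volume.restrict (ball y (2 * 1)))) := by
            rw [Measure.prod_restrict, ← Measure.volume_eq_prod]
        _ ≤ ∫⁻ t in Ioo (5 - (2 * 1) ^ 2) 5, ∫⁻ x in ball y (2 * 1),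
              ‖stPull 1 1 c 0 g t x‖ₑ := lintegral_prod_le _
        _ ≤ ∫⁻ _ in Ioo (5 - (2 * 1) ^ 2) (5 : ℝ), B := by
            refine lintegral_mono_ae ?_
            filter_upwards [hgood, ae_restrict_mem measurableSet_Ioo] with t ht htmem
            exact hslice t ht (by have := htmem.2; linarith)
        _ = 4 * B := by
            rw [setLIntegral_const, Real.volume_Ioo, mul_comm]
            norm_num
    have hI_le : (∫ q in S, max (stPull 1 1 c 0 g q.1 q.2) 0) ≤ (4 * B).toReal := by
      rw [hI_eq]
      exact ENNReal.toReal_mono h4B hlin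
    -- conclusion
    calc g t₀ y ≤ C * ((∫ q in S, max (stPull 1 1 c 0 g q.1 q.2) 0) + 1) := hlm
      _ ≤ C * ((4 * B).toReal + 1) := by gcongr
  -- apply to `f` and `-f`
  refine ⟨C * ((4 * B).toReal + 1), fun t ht x hx => ?_⟩
  have hpos := key f h0 h1 h2 h3 heq (fun _ _ => rfl) t ht x hx
  have hneg_fun : ∀ s, (fun z => -f s z) = -(f s) := fun s => rfl
  have hneg := key (fun s z => -f s z) ?_ (fun s hs => (h1 s hs).neg) ?_ ?_ ?_
    (fun s z => abs_neg _) t ht x hx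
  · exact abs_le.2 ⟨by linarith, hpos⟩
  · exact h0.neg
  · have : (fun q : ℝ × (EuclideanSpace ℝ (Fin 3)) => fderiv ℝ (fun z => -f q.1 z) q.2) =
        fun q => -fderiv ℝ (f q.1) q.2 := funext fun q => fderiv_fun_neg
    rw [this]
    exact h2.neg
  · have : (fun q : ℝ × (EuclideanSpace ℝ (Fin 3)) => (Δ fun z => -f q.1 z) q.2) = fun q => -(Δ (f q.1)) q.2 :=
      funext fun q => by rw [hneg_fun, InnerProductSpace.laplacian_neg]; rfl
    rw [this]
    exact h3.neg
  · intro z hz s t' hst ht'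
    have hint : (fun τ => (Δ fun w => -f τ w) z - fderiv ℝ (fun w => -f τ w) z (a τ z)) =
        fun τ => -((Δ (f τ)) z - fderiv ℝ (f τ) z (a τ z)) := by
      funext τ
      rw [hneg_fun, InnerProductSpace.laplacian_neg, fderiv_neg]
      simp only [Pi.neg_apply, neg_apply]
      ring
    rw [hint, intervalIntegral.integral_neg, ← heq z hz s t' hst ht']
    ring

/-! ### The Liouville step for the swirl (LZZ 2017, Lemma 5.2) from KNSS's Lemma 2.1 -/

/-- The thin cylinder `{r < ρ, |z| < c}` about the axis is open. [folklore] -/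
theorem isOpen_setOf_cylRadius_lt_abs_lt (ρ c : ℝ) :
    IsOpen {y : (EuclideanSpace ℝ (Fin 3)) | cylRadius y < ρ ∧ |y 2| < c} := by
  have h2 : Continuous fun y : (EuclideanSpace ℝ (Fin 3)) => |y 2| := continuous_abs.comp (PiLp.continuous_apply 2 _ 2)
  exact (isOpen_lt continuous_cylRadius continuous_const).inter (isOpen_lt h2 continuous_const)

/-- The thin cylinder `{r < ρ, |z| < c}` is convex (`r` and `|z|` are seminorms). [folklore] -/
theorem convex_setOf_cylRadius_lt_abs_lt (ρ c : ℝ) :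
    Convex ℝ {y : (EuclideanSpace ℝ (Fin 3)) | cylRadius y < ρ ∧ |y 2| < c} := by
  have h1 : Convex ℝ {y : (EuclideanSpace ℝ (Fin 3)) | cylRadius y < ρ} := by
    have hc : ConvexOn ℝ univ (cylRadius : (EuclideanSpace ℝ (Fin 3)) → ℝ) := by
      refine ⟨convex_univ, fun x _ y _ a b ha hb _ => ?_⟩
      calc cylRadius (a • x + b • y) ≤ cylRadius (a • x) + cylRadius (b • y) :=
            SereginSverak2009.cylRadius_add_le _ _
        _ = a • cylRadius x + b • cylRadius y := by
            rw [cylRadius_smul, cylRadius_smul, abs_of_nonneg ha, abs_of_nonneg hb]; rfl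
    simpa using hc.convex_lt ρ
  have h2 : Convex ℝ {y : (EuclideanSpace ℝ (Fin 3)) | |y 2| < c} := by
    have hc : ConvexOn ℝ univ (fun y : (EuclideanSpace ℝ (Fin 3)) => |y 2|) := by
      refine ⟨convex_univ, fun x _ y _ a b ha hb _ => ?_⟩
      simp only [PiLp.add_apply, PiLp.smul_apply, smul_eq_mul]
      calc |a * x 2 + b * y 2| ≤ |a * x 2| + |b * y 2| := abs_add_le _ _
        _ = a * |x 2| + b * |y 2| := by rw [abs_mul, abs_mul, abs_of_nonneg ha, abs_of_nonneg hb]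
    simpa using hc.convex_lt c
  exact h1.inter h2

/-- **Lei–Zhang–Zhao 2017, Lemma 5.2: the Liouville step for the swirl equation**
(arXiv:1701.00868, §5, pp. 11–12: "Since `Γ = r v_θ`, we have `Γ|_{r=0} = 0`. We are going to use
a contradiction argument and maximum principle to prove `Γ ≡ 0`. Suppose `M = sup Γ ≥ 0` …
Case 1 [`M` attained]: … `Γ ≡ M` on `(ℝ³ ∖ {r = 0}) × (−∞, 0)`, which induces a contradiction
with `Γ ≡ 0` on `{r = 0}` …; Case 2 [`M` approached at infinity]: … translated sequence
`v_k(y,s) = v(x_k + y, t_k + s)` … limit … strong maximum principle … Similar to Case 1").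
**Statement** (for the elementary class, with the `L^∞_t L^p_x` hypothesis of Theorem 1.3 in
place of the decay furnished by Lemma 5.1): let `f` have `C²` slices with `∇f`, `Δf` jointly
continuous on `(−∞, 0) × ℝ³`, `|f| ≤ C₁ r` (so `f = 0` on the axis, quantitatively) and
`|f| ≤ C_f`; let the drift `a` be jointly measurable and bounded on every region `{r ≥ ρ}`,
`ρ > 0`; let `f(t,x) − f(s,x) = ∫ₛᵗ (Δf − Df[a])` off the axis; and let
`‖f(t,·)‖_{L^p} ≤ K < ∞` for a.e. `t < 0`, `0 < p < ∞`. Then `f ≡ 0` on `(−∞, 0) × ℝ³`.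
**Proof** (the tree's replacement of the printed compactness argument — KNSS 2009, Lemma 6.1 and
the strong maximum principle — by KNSS's *stability* form of the strong maximum principle,
Lemma 2.1 = `KNSS2009_lemma21_holds`, exactly as KNSS themselves prove their Theorem 5.3): if
`M = sup |f| > 0`, a point with `|f(t₁,x₁)| > M − min(Mδ, M/2)` lies at distance `≥ 2ρ₀ = M/(2C₁)`
from the axis; translating it to the centre of the thin cylinder
`Ω = {r < ρ₀, |z| < L + 2}` (on `x₁ + Ω` the merged drift is bounded uniformly), Lemma 2.1 with
`K = {0}`, `Ω' = {r ≤ ρ₀/2, |z| ≤ L}`, `T = 2`, `τ = 1`, `ε = 1/2` applied to `±f` gives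
`|f| ≥ M/2` on `x₁ + Ω'` at all times of `(t₁ − 1, t₁)`; at a time where the `L^p` bound holds
this forces `K^p ≥ (M/2)^p · 2L · |B̄_{ρ₀/2}(ℝ²)|`, false for `L` large. [cite: LeiZhangZhao2017, Lemma 5.2 (arXiv pp. 11–12); KochNadirashviliSereginSverak2009, Lemma 2.1 (arXiv p. 5)] -/
theorem driftHeat_eq_zero_of_eLpNorm_le {f : ℝ → (EuclideanSpace ℝ (Fin 3)) → ℝ} {a : ℝ → (EuclideanSpace ℝ (Fin 3)) → (EuclideanSpace ℝ (Fin 3))} {C₁ Cf : ℝ}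
    {p : ℝ≥0∞} {K : ℝ≥0∞}
    (h1 : ∀ t < 0, ContDiff ℝ 2 (f t))
    (h2 : ContinuousOn (fun q : ℝ × (EuclideanSpace ℝ (Fin 3)) => fderiv ℝ (f q.1) q.2) (Iio 0 ×ˢ univ))
    (h3 : ContinuousOn (fun q : ℝ × (EuclideanSpace ℝ (Fin 3)) => (Δ (f q.1)) q.2) (Iio 0 ×ˢ univ))
    (h4 : ∀ t < 0, ∀ x, |f t x| ≤ C₁ * cylRadius x)
    (h5 : ∀ t < 0, ∀ x, |f t x| ≤ Cf)
    (ha : Measurable (uncurry a))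
    (hA : ∀ ρ > 0, ∃ A, ∀ t < 0, ∀ x, ρ ≤ cylRadius x → ‖a t x‖ ≤ A)
    (hp0 : p ≠ 0) (hpt : p ≠ ⊤) (hK : K ≠ ⊤)
    (hLp : ∀ᵐ t ∂((volume : Measure ℝ).restrict (Iio 0)), eLpNorm (f t) p volume ≤ K)
    (heq : ∀ x, cylRadius x ≠ 0 → ∀ s t : ℝ, s ≤ t → t < 0 →
      f t x - f s x = ∫ τ in s..t, ((Δ (f τ)) x - fderiv ℝ (f τ) x (a τ x))) :
    ∀ t < 0, ∀ x, f t x = 0 := by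
  by_contra hne
  push Not at hne
  obtain ⟨t₀, ht₀, x₀, hx₀⟩ := hne
  have hp_pos : 0 < p.toReal := ENNReal.toReal_pos hp0 hpt
  -- the supremum `M` of `|f|`
  set S : Set ℝ := {v | ∃ t < 0, ∃ x, |f t x| = v} with hS_def
  have hbdd : BddAbove S := ⟨Cf, by rintro v ⟨t, ht, x, rfl⟩; exact h5 t ht x⟩
  have hmemS : ∀ t < 0, ∀ x, |f t x| ∈ S := fun t ht x => ⟨t, ht, x, rfl⟩
  set M : ℝ := sSup S with hM_def
  have hfM : ∀ t < 0, ∀ x, |f t x| ≤ M := fun t ht x => le_csSup hbdd (hmemS t ht x)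
  have hM : 0 < M := lt_of_lt_of_le (abs_pos.2 hx₀) (hfM t₀ ht₀ x₀)
  have happr : ∀ η > 0, ∃ t < 0, ∃ x, M - η < |f t x| := by
    intro η hη
    obtain ⟨v, ⟨t, ht, x, rfl⟩, hv⟩ :=
      exists_lt_of_lt_csSup ⟨_, hmemS t₀ ht₀ x₀⟩ (by linarith : M - η < M)
    exact ⟨t, ht, x, hv⟩
  -- `C₁ > 0`, `ρ₀ = M / (4 C₁)`: points with `|f| ≥ M/2` are at distance `≥ 2ρ₀` from the axis
  have hC₁ : 0 < C₁ := by
    have h := h4 t₀ ht₀ x₀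
    have hpos : 0 < |f t₀ x₀| := abs_pos.2 hx₀
    by_contra hle
    push Not at hle
    have : C₁ * cylRadius x₀ ≤ 0 := mul_nonpos_of_nonpos_of_nonneg hle (cylRadius_nonneg _)
    linarith
  set ρ₀ : ℝ := M / (4 * C₁) with hρ₀_def
  have hρ₀ : 0 < ρ₀ := by positivity
  have hoff : ∀ t < 0, ∀ x, M / 2 ≤ |f t x| → 2 * ρ₀ ≤ cylRadius x := by
    intro t ht x hx
    have h : M / 2 ≤ C₁ * cylRadius x := hx.trans (h4 t ht x)
    have hcalc : 2 * ρ₀ = (M / 2) / C₁ := by rw [hρ₀_def]; field_simp; ring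
    rw [hcalc, div_le_iff₀ hC₁]
    linarith
  obtain ⟨A, hAρ⟩ := hA ρ₀ hρ₀
  -- the equation on `{r ≥ ρ₀}`
  have heqρ : ∀ x, ρ₀ ≤ cylRadius x → ∀ s t : ℝ, s ≤ t → t < 0 →
      f t x - f s x = ∫ τ in s..t, ((Δ (f τ)) x - fderiv ℝ (f τ) x (a τ x)) :=
    fun x hx => heq x (by linarith)
  -- the volume scale `v = |B̄_{ρ₀/2}(ℝ²)|` and the length `L`
  set v : ℝ≥0∞ := volume (closedBall (0 : EuclideanSpace ℝ (Fin 2)) (ρ₀ / 2)) with hv_def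
  have hv0 : v ≠ 0 := (Metric.measure_closedBall_pos volume _ (by positivity)).ne'
  have hvt : v ≠ ⊤ := measure_closedBall_lt_top.ne
  have hvr : 0 < v.toReal := ENNReal.toReal_pos hv0 hvt
  set m : ℝ := (M / 2) ^ p.toReal with hm_def
  have hm : 0 < m := Real.rpow_pos_of_pos (by positivity) _
  have hKpfin : K ^ p.toReal ≠ ⊤ := ENNReal.rpow_ne_top_of_nonneg hp_pos.le hK
  set Kp : ℝ := (K ^ p.toReal).toReal with hKp_def
  have hKp : 0 ≤ Kp := ENNReal.toReal_nonneg
  set L : ℝ := Kp / (2 * m * v.toReal) + 1 with hL_def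
  have hL0 : 0 < L := by
    have : 0 ≤ Kp / (2 * m * v.toReal) := by positivity
    linarith
  have hbig : K ^ p.toReal < ENNReal.ofReal m * (ENNReal.ofReal (2 * L) * v) := by
    rw [← ENNReal.ofReal_toReal hKpfin, ← ENNReal.ofReal_toReal hvt,
      ← ENNReal.ofReal_mul (by positivity), ← ENNReal.ofReal_mul hm.le,
      ENNReal.ofReal_lt_ofReal_iff (by positivity)]
    have hid : m * (2 * L * v.toReal) = Kp + 2 * m * v.toReal := by
      rw [hL_def]; field_simp
    show Kp < m * (2 * L * v.toReal)
    rw [hid]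
    linarith [mul_pos (mul_pos two_pos hm) hvr]
  -- the configuration of Lemma 2.1
  set Ω : Set (EuclideanSpace ℝ (Fin 3)) := {y | cylRadius y < ρ₀ ∧ |y 2| < L + 2} with hΩ_def
  set Ω' : Set (EuclideanSpace ℝ (Fin 3)) := solidCylinder (ρ₀ / 2) L with hΩ'_def
  have hΩo : IsOpen Ω := isOpen_setOf_cylRadius_lt_abs_lt _ _
  have hΩb : Bornology.IsBounded Ω :=
    (isCompact_solidCylinder ρ₀ (L + 2)).isBounded.subset fun y hy => ⟨hy.1.le, hy.2.le⟩
  have h0Ω : (0 : (EuclideanSpace ℝ (Fin 3))) ∈ Ω := by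
    refine ⟨?_, ?_⟩
    · show cylRadius 0 < ρ₀
      have : cylRadius (0 : (EuclideanSpace ℝ (Fin 3))) = 0 := by simp [cylRadius]
      rw [this]; exact hρ₀
    · show |(0 : (EuclideanSpace ℝ (Fin 3))) 2| < L + 2
      simp only [PiLp.zero_apply, abs_zero]
      linarith
  have hΩc : IsConnected Ω := (convex_setOf_cylRadius_lt_abs_lt _ _).isConnected ⟨0, h0Ω⟩
  have hcl : closure Ω' ⊆ Ω := by
    rw [(isCompact_solidCylinder _ _).isClosed.closure_eq]
    intro y hy
    exact ⟨by linarith [hy.1], by linarith [hy.2]⟩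
  have hKc : IsCompact ({0} : Set (EuclideanSpace ℝ (Fin 3))) := isCompact_singleton
  have hKΩ : ({0} : Set (EuclideanSpace ℝ (Fin 3))) ⊆ Ω := by
    intro y hy
    rw [mem_singleton_iff] at hy
    rw [hy]
    exact h0Ω
  obtain ⟨δ, hδ, hP⟩ := KNSS2009_lemma21_holds (EuclideanSpace ℝ (Fin 3)) (T := 2) (τ := 1)
    (A := A) (ε := 1 / 2) hΩo hΩb hΩc hcl hKc hKΩ one_pos (by norm_num)
  -- the one-sided plateau from Lemma 2.1, for every `g` of the class with `|g| ≤ M`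
  have key : ∀ g : ℝ → (EuclideanSpace ℝ (Fin 3)) → ℝ, (∀ t < 0, ContDiff ℝ 2 (g t)) →
      ContinuousOn (fun q : ℝ × (EuclideanSpace ℝ (Fin 3)) => fderiv ℝ (g q.1) q.2) (Iio 0 ×ˢ univ) →
      ContinuousOn (fun q : ℝ × (EuclideanSpace ℝ (Fin 3)) => (Δ (g q.1)) q.2) (Iio 0 ×ˢ univ) →
      (∀ x, ρ₀ ≤ cylRadius x → ∀ s t : ℝ, s ≤ t → t < 0 →
        g t x - g s x = ∫ τ in s..t, ((Δ (g τ)) x - fderiv ℝ (g τ) x (a τ x))) →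
      (∀ t < 0, ∀ x, |g t x| ≤ M) →
      ∀ t₁ < 0, ∀ x₁ : (EuclideanSpace ℝ (Fin 3)), 2 * ρ₀ ≤ cylRadius x₁ → M * (1 - δ) ≤ g t₁ x₁ →
        ∀ s ∈ Ioo (1 : ℝ) 2, ∀ y ∈ Ω', M * (1 - 1 / 2) ≤ g (t₁ - 2 + s) (x₁ + y) := by
    intro g hg1 hg2 hg3 hgeq hgM t₁ ht₁ x₁ hx₁ hnear s hs y hy
    have hT : t₁ - 2 + 2 < 0 := by linarith
    have hΩr : ∀ z ∈ Ω, ρ₀ ≤ cylRadius (x₁ + z) := fun z hz => by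
      have := cylRadius_sub_le_cylRadius_add x₁ z
      linarith [hz.1]
    obtain ⟨hm', hbd, hC2, hco1, hco2, hEq⟩ := driftHeat_translate_data (T := 2) (x₀ := x₁)
      (Ω := Ω) hg1 hg2 hg3 ha hAρ hgeq hT hΩr
    have hbound : ∀ s ∈ Ioc (0 : ℝ) 2, ∀ z ∈ Ω, |stPull 1 1 (t₁ - 2) x₁ g s z| ≤ M :=
      fun s hs z _ => by
        simp only [stPull_apply, one_mul, one_smul]
        exact hgM _ (by linarith [hs.2]) _
    have hval : stPull 1 1 (t₁ - 2) x₁ g 2 0 = g t₁ x₁ := by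
      simp only [stPull_apply, one_mul, smul_zero, add_zero, sub_add_cancel]
    have hnear' : ∃ z ∈ ({0} : Set (EuclideanSpace ℝ (Fin 3))), M * (1 - δ) ≤ stPull 1 1 (t₁ - 2) x₁ g 2 z :=
      ⟨0, mem_singleton _, by rw [hval]; exact hnear⟩
    have hres := hP hm' hbd hC2 hco1 hco2 hEq hM hbound hnear' s hs y hy
    simpa only [stPull_apply, one_mul, one_smul] using hres
  -- a near-maximum point
  set η : ℝ := min (M * δ) (M / 2) with hη_def
  have hη : 0 < η := lt_min (by positivity) (by positivity)
  obtain ⟨t₁, ht₁, x₁, hnear⟩ := happr η hη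
  have hnear1 : M * (1 - δ) ≤ |f t₁ x₁| := by
    have := min_le_left (M * δ) (M / 2)
    rw [mul_sub, mul_one]
    linarith
  have hnear2 : M / 2 ≤ |f t₁ x₁| := by
    have := min_le_right (M * δ) (M / 2)
    linarith
  have hx₁ : 2 * ρ₀ ≤ cylRadius x₁ := hoff t₁ ht₁ x₁ hnear2
  -- the plateau `|f| ≥ M/2` on `x₁ + Ω'` during `(t₁ - 1, t₁)`, from `key` for `f` or `-f`
  have hplateau : ∀ s ∈ Ioo (1 : ℝ) 2, ∀ y ∈ Ω', M / 2 ≤ |f (t₁ - 2 + s) (x₁ + y)| := by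
    intro s hs y hy
    rcases le_or_gt 0 (f t₁ x₁) with hsgn | hsgn
    · have h := key f h1 h2 h3 heqρ hfM t₁ ht₁ x₁ hx₁ (by rwa [abs_of_nonneg hsgn] at hnear1)
        s hs y hy
      have : M * (1 - 1 / 2) = M / 2 := by ring
      linarith [le_abs_self (f (t₁ - 2 + s) (x₁ + y))]
    · have hneg_fun : ∀ τ, (fun z => -f τ z) = -(f τ) := fun τ => rfl
      have hg2 : ContinuousOn (fun q : ℝ × (EuclideanSpace ℝ (Fin 3)) => fderiv ℝ (fun z => -f q.1 z) q.2)
          (Iio 0 ×ˢ univ) := by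
        have : (fun q : ℝ × (EuclideanSpace ℝ (Fin 3)) => fderiv ℝ (fun z => -f q.1 z) q.2) =
            fun q => -fderiv ℝ (f q.1) q.2 := funext fun q => fderiv_fun_neg
        rw [this]
        exact h2.neg
      have hg3 : ContinuousOn (fun q : ℝ × (EuclideanSpace ℝ (Fin 3)) => (Δ fun z => -f q.1 z) q.2) (Iio 0 ×ˢ univ) := by
        have : (fun q : ℝ × (EuclideanSpace ℝ (Fin 3)) => (Δ fun z => -f q.1 z) q.2) = fun q => -(Δ (f q.1)) q.2 :=
          funext fun q => by rw [hneg_fun, InnerProductSpace.laplacian_neg]; rfl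
        rw [this]
        exact h3.neg
      have hgeq : ∀ x, ρ₀ ≤ cylRadius x → ∀ s t : ℝ, s ≤ t → t < 0 →
          (-f t x) - (-f s x) = ∫ τ in s..t, ((Δ fun z => -f τ z) x -
            fderiv ℝ (fun z => -f τ z) x (a τ x)) := by
        intro z hz s' t' hst ht'
        have hint : (fun τ => (Δ fun w => -f τ w) z - fderiv ℝ (fun w => -f τ w) z (a τ z)) =
            fun τ => -((Δ (f τ)) z - fderiv ℝ (f τ) z (a τ z)) := by
          funext τ
          rw [hneg_fun, InnerProductSpace.laplacian_neg, fderiv_neg]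
          simp only [Pi.neg_apply, neg_apply]
          ring
        rw [hint, intervalIntegral.integral_neg, ← heqρ z hz s' t' hst ht']
        ring
      have h := key (fun τ z => -f τ z) (fun τ hτ => (h1 τ hτ).neg) hg2 hg3 hgeq
        (fun τ hτ z => by rw [abs_neg]; exact hfM τ hτ z) t₁ ht₁ x₁ hx₁
        (by rwa [abs_of_neg hsgn] at hnear1) s hs y hy
      have : M * (1 - 1 / 2) = M / 2 := by ring
      linarith [neg_abs_le (f (t₁ - 2 + s) (x₁ + y))]
  -- a time of `(t₁ - 1, t₁)` at which the `L^p` bound holds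
  have hgood : ∀ᵐ s ∂((volume : Measure ℝ).restrict (Ioo (1 : ℝ) 2)),
      eLpNorm (f (t₁ - 2 + s)) p volume ≤ K :=
    ae_restrict_Ioo_comp_add_of_ae_restrict_Iio hLp (by linarith)
  obtain ⟨s, hs, hsK⟩ : ∃ s ∈ Ioo (1 : ℝ) 2, eLpNorm (f (t₁ - 2 + s)) p volume ≤ K := by
    have hne : (volume : Measure ℝ).restrict (Ioo (1 : ℝ) 2) ≠ 0 := by
      rw [Ne, Measure.restrict_eq_zero, Real.volume_Ioo]
      norm_num
    haveI : (ae ((volume : Measure ℝ).restrict (Ioo (1 : ℝ) 2))).NeBot := ae_neBot.2 hne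
    obtain ⟨s, hsK, hs⟩ := (hgood.and (ae_restrict_mem measurableSet_Ioo)).exists
    exact ⟨s, hs, hsK⟩
  -- lower bound for `∫ |f(t*)|^p` on the translated block `x₁ + Ω'`
  set T' : Set (EuclideanSpace ℝ (Fin 3)) := (fun z => -x₁ + z) ⁻¹' Ω' with hT'_def
  have hT'm : MeasurableSet T' := (measurable_const_add (-x₁)) (measurableSet_solidCylinder _ _)
  have hT'vol : volume T' = ENNReal.ofReal (2 * L) * v := by
    rw [hT'_def, measure_preimage_add, hΩ'_def, volume_solidCylinder]
  have hlow : ENNReal.ofReal m * (ENNReal.ofReal (2 * L) * v) ≤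
      ∫⁻ z, ‖f (t₁ - 2 + s) z‖ₑ ^ p.toReal := by
    rw [← hT'vol, ← setLIntegral_const]
    refine (setLIntegral_mono' hT'm fun z hz => ?_).trans (setLIntegral_le_lintegral T' _)
    have hz' : -x₁ + z ∈ Ω' := hz
    have hpl := hplateau s hs (-x₁ + z) hz'
    rw [show x₁ + (-x₁ + z) = z by abel] at hpl
    rw [Real.enorm_eq_ofReal_abs, hm_def, ENNReal.ofReal_rpow_of_nonneg (abs_nonneg _) hp_pos.le]
    exact ENNReal.ofReal_le_ofReal (Real.rpow_le_rpow (by positivity) hpl hp_pos.le)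
  have hup : ∫⁻ z, ‖f (t₁ - 2 + s) z‖ₑ ^ p.toReal ≤ K ^ p.toReal := by
    rw [lintegral_rpow_enorm_eq_rpow_eLpNorm' hp_pos, ← eLpNorm_eq_eLpNorm' hp0 hpt]
    exact ENNReal.rpow_le_rpow hsK hp_pos.le
  exact absurd (hlow.trans hup) (not_le.2 hbig)

/-! ### Theorem 1.3 in KNSS's printed class of bounded weak solutions -/

/-- **Lei–Zhang–Zhao 2017, Theorem 1.3, the swirl vanishes — in the printed class.** Let `u` be
a bounded weak solution of Navier–Stokes (`ν = 1`) in `ℝ³ × (−∞, 0)` in the sense of KNSS 2009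
(`IsBoundedWeakNSSolutionOn`), axisymmetric as an `L^∞` function, whose swirl `Γ = x₀u₁ − x₁u₀`
satisfies `‖Γ(t, ·)‖_{L^p(ℝ³)} ≤ K` for a.e. `t < 0`, for some `1 ≤ p < ∞`. Then `Γ = 0` a.e., for
a.e. `t < 0` (arXiv:1701.00868, §5: Lemma 5.1 + Lemma 5.2 up to "Hence `Γ ≡ 0` … which implies
`v_θ ≡ 0`"). **Proof.** KNSS's §4 regularity with the swirl equation (5.10) for the axisymmetric
representative `U`, `u = U + β(t)e_z` a.e. (`KNSS2009_regularity_axisymmetric_swirl_holds`),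
makes `f = swirl U` a member of the elementary class with the merged drift
`U + βe_z + (2/r)e_r` (bounded on every `{r ≥ ρ}`), `|f| ≤ r‖U‖_∞`, `∇f`, `Δf` jointly continuous
by (4.8) and the swirl calculus (as in the tree's `KNSS2009_thm53_ae_swirl_free`), and
`‖f(t)‖_p = ‖Γ(t)‖_p ≤ K` for a.e. `t`; `f` is bounded by the mean-value step
(`driftHeat_bounded_of_eLpNorm_le`, printed Lemma 5.1, Step 1) and vanishes by the Liouville
step (`driftHeat_eq_zero_of_eLpNorm_le`, printed Lemma 5.2). [cite: LeiZhangZhao2017, Thm 1.3 with Lemmas 5.1–5.2 (arXiv pp. 4, 10–12)] -/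
theorem leiZhangZhao2017_Lp_ae_swirl_free {u : ℝ → (EuclideanSpace ℝ (Fin 3)) → (EuclideanSpace ℝ (Fin 3))}
    (hu : IsBoundedWeakNSSolutionOn (Iio 0) isOpen_Iio 1 u)
    (haxi : ∀ θ : ℝ, ∀ᵐ t ∂((volume : Measure ℝ).restrict (Iio 0)),
      (fun x => u t (rotZ θ x)) =ᵐ[volume] fun x => rotZ θ (u t x))
    (hLp : ∃ (p : ℝ≥0∞) (K : ℝ≥0), 1 ≤ p ∧ p < (⊤ : ℝ≥0∞) ∧
      ∀ᵐ t ∂((volume : Measure ℝ).restrict (Iio 0)), eLpNorm (swirl (u t)) p volume ≤ K) :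
    ∀ᵐ t ∂((volume : Measure ℝ).restrict (Iio 0)), swirl (u t) =ᵐ[volume] (0 : (EuclideanSpace ℝ (Fin 3)) → ℝ) := by
  obtain ⟨U, β, hβm, ⟨Cβ, hCβ⟩, hUm, hrep, hsmooth, -, -, hbdU, hlip, hswirlEq⟩ :=
    KNSS2009_regularity_axisymmetric_swirl_holds hu haxi
  obtain ⟨p, K, hp1, hpt, hK⟩ := hLp
  have hp0 : p ≠ 0 := (lt_of_lt_of_le one_pos hp1).ne'
  set S : Set (ℝ × (EuclideanSpace ℝ (Fin 3))) := Iio 0 ×ˢ univ with hS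
  -- smoothness of the slices in the degrees used below
  have hU2 : ∀ t < 0, ContDiff ℝ 2 (U t) := fun t ht => (hsmooth t ht).of_le (by norm_cast)
  have hU1 : ∀ t < 0, ContDiff ℝ 1 (U t) := fun t ht => (hsmooth t ht).of_le (by norm_cast)
  have hUd : ∀ t < 0, ∀ x, DifferentiableAt ℝ (U t) x := fun t ht x =>
    ((hU1 t ht).differentiable one_ne_zero) x
  -- (4.8) ⇒ joint continuity of `U`, `∇U`, `∇²U`
  have hD : ∀ k : ℕ, ContinuousOn (fun q : ℝ × (EuclideanSpace ℝ (Fin 3)) => iteratedFDeriv ℝ k (U q.1) q.2) S := by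
    intro k
    obtain ⟨L, hL⟩ := hlip k
    exact continuousOn_iteratedFDeriv_of_lipschitz hsmooth hL
  have hUc : ContinuousOn (fun q : ℝ × (EuclideanSpace ℝ (Fin 3)) => U q.1 q.2) S := by
    have h := (ContinuousMultilinearMap.apply ℝ (fun _ : Fin 0 => (EuclideanSpace ℝ (Fin 3))) (EuclideanSpace ℝ (Fin 3))
      (Fin.elim0 : Fin 0 → (EuclideanSpace ℝ (Fin 3)))).continuous.comp_continuousOn (hD 0)
    refine h.congr fun q _ => ?_
    simp only [comp_apply, ContinuousMultilinearMap.apply_apply, iteratedFDeriv_zero_apply]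
  have hD1c : ∀ y : (EuclideanSpace ℝ (Fin 3)), ContinuousOn (fun q : ℝ × (EuclideanSpace ℝ (Fin 3)) => fderiv ℝ (U q.1) q.2 y) S := by
    intro y
    have h := (ContinuousMultilinearMap.apply ℝ (fun _ : Fin 1 => (EuclideanSpace ℝ (Fin 3))) (EuclideanSpace ℝ (Fin 3))
      (fun _ => y)).continuous.comp_continuousOn (hD 1)
    refine h.congr fun q _ => ?_
    simp only [comp_apply, ContinuousMultilinearMap.apply_apply, iteratedFDeriv_one_apply]
  have hD2c : ∀ m : Fin 2 → (EuclideanSpace ℝ (Fin 3)),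
      ContinuousOn (fun q : ℝ × (EuclideanSpace ℝ (Fin 3)) => iteratedFDeriv ℝ 2 (U q.1) q.2 m) S := fun m =>
    (ContinuousMultilinearMap.apply ℝ (fun _ : Fin 2 => (EuclideanSpace ℝ (Fin 3))) (EuclideanSpace ℝ (Fin 3)) m).continuous.comp_continuousOn
      (hD 2)
  -- (4.7), `k = 0`: `‖U‖ ≤ C₀`
  obtain ⟨C0, hC0⟩ := hbdU 0
  have hUbd : ∀ t < 0, ∀ x, ‖U t x‖ ≤ C0 := fun t ht x => by
    rw [← norm_iteratedFDeriv_zero (𝕜 := ℝ)]; exact hC0 t ht x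
  have hC0nn : 0 ≤ C0 := (norm_nonneg _).trans (hUbd (-1) (by norm_num) 0)
  have hCβnn : 0 ≤ Cβ := (abs_nonneg _).trans (hCβ 0)
  -- the scalar `f = swirl U` and the merged drift `a = U + β e_z + (2/r) e_r`
  set f : ℝ → (EuclideanSpace ℝ (Fin 3)) → ℝ := fun t x => swirl (U t) x with hf_def
  set a : ℝ → (EuclideanSpace ℝ (Fin 3)) → (EuclideanSpace ℝ (Fin 3)) := fun t x => U t x + β t • eZ + (2 / cylRadius x) • eR x with ha_def
  have h1 : ∀ t < 0, ContDiff ℝ 2 (f t) := fun t ht => contDiff_swirl (hU2 t ht)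
  have h0 : ContinuousOn (uncurry f) S := by
    have hc : ContinuousOn (fun q : ℝ × (EuclideanSpace ℝ (Fin 3)) => q.2 0 * U q.1 q.2 1 - q.2 1 * U q.1 q.2 0) S :=
      ((((PiLp.continuous_apply 2 _ 0).comp continuous_snd).continuousOn.mul
        ((PiLp.continuous_apply 2 _ 1).comp_continuousOn hUc)).sub
        (((PiLp.continuous_apply 2 _ 1).comp continuous_snd).continuousOn.mul
        ((PiLp.continuous_apply 2 _ 0).comp_continuousOn hUc)))
    refine hc.congr fun q _ => ?_
    simp only [hf_def, swirl]
    rfl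
  have h2 : ContinuousOn (fun q : ℝ × (EuclideanSpace ℝ (Fin 3)) => fderiv ℝ (f q.1) q.2) S := by
    refine continuousOn_clm_apply.2 fun y => ?_
    have hG : ContinuousOn
        (fun q : ℝ × (EuclideanSpace ℝ (Fin 3)) => ⟪rotGen q.2, fderiv ℝ (U q.1) q.2 y⟫ + ⟪rotGen y, U q.1 q.2⟫) S :=
      ((rotGenL.continuous.comp continuous_snd).continuousOn.inner (hD1c y)).add
        (continuousOn_const.inner hUc)
    refine hG.congr fun q hq => ?_
    exact fderiv_swirl_apply (hUd q.1 hq.1 q.2) y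
  have h3 : ContinuousOn (fun q : ℝ × (EuclideanSpace ℝ (Fin 3)) => (Δ (f q.1)) q.2) S := by
    classical
    set b := EuclideanSpace.basisFun (Fin 3) ℝ with hb
    have hΔU : ContinuousOn (fun q : ℝ × (EuclideanSpace ℝ (Fin 3)) => (Δ (U q.1)) q.2) S := by
      have h : ContinuousOn
          (fun q : ℝ × (EuclideanSpace ℝ (Fin 3)) => ∑ i, iteratedFDeriv ℝ 2 (U q.1) q.2 ![b i, b i]) S :=
        continuousOn_finsetSum _ fun i _ => hD2c _
      refine h.congr fun q _ => ?_
      exact congrFun (laplacian_eq_iteratedFDeriv_orthonormalBasis (U q.1) b) q.2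
    have hG : ContinuousOn (fun q : ℝ × (EuclideanSpace ℝ (Fin 3)) => ⟪rotGen q.2, (Δ (U q.1)) q.2⟫ +
        2 * (fderiv ℝ (U q.1) q.2 (EuclideanSpace.single 0 1) 1 -
          fderiv ℝ (U q.1) q.2 (EuclideanSpace.single 1 1) 0)) S :=
      ((rotGenL.continuous.comp continuous_snd).continuousOn.inner hΔU).add
        (continuousOn_const.mul
          (((PiLp.continuous_apply 2 _ 1).comp_continuousOn (hD1c _)).sub
            ((PiLp.continuous_apply 2 _ 0).comp_continuousOn (hD1c _))))
    refine hG.congr fun q hq => ?_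
    exact laplacian_swirl (hU2 q.1 hq.1) q.2
  have h4 : ∀ t < 0, ∀ x, |f t x| ≤ C0 * cylRadius x := fun t ht x => by
    rw [mul_comm]
    exact (abs_swirl_le_cylRadius_mul_norm (U t) x).trans
      (mul_le_mul_of_nonneg_left (hUbd t ht x) (cylRadius_nonneg x))
  have ha : Measurable (uncurry a) := by
    have h1' : Measurable fun q : ℝ × (EuclideanSpace ℝ (Fin 3)) => (2 / cylRadius q.2) • eR q.2 :=
      ((measurable_const.div continuous_cylRadius.measurable).comp measurable_snd).smul
        (measurable_eR.comp measurable_snd)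
    show Measurable fun q : ℝ × (EuclideanSpace ℝ (Fin 3)) => U q.1 q.2 + β q.1 • eZ + (2 / cylRadius q.2) • eR q.2
    exact (hUm.add ((hβm.comp measurable_fst).smul_const eZ)).add h1'
  have hA : ∀ ρ > 0, ∃ A, ∀ t < 0, ∀ x, ρ ≤ cylRadius x → ‖a t x‖ ≤ A := by
    intro ρ hρ
    refine ⟨C0 + Cβ + 2 / ρ, fun t ht x hx => ?_⟩
    have hr0 : 0 < cylRadius x := lt_of_lt_of_le hρ hx
    have hE : ‖(2 / cylRadius x) • eR x‖ ≤ 2 / ρ := by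
      rw [norm_smul, Real.norm_eq_abs, abs_of_nonneg (by positivity)]
      calc 2 / cylRadius x * ‖eR x‖ ≤ 2 / cylRadius x * 1 := by
            gcongr; exact norm_eR_le_one x
        _ ≤ 2 / ρ := by rw [mul_one]; exact div_le_div_of_nonneg_left (by norm_num) hρ hx
    have hZ : ‖β t • (eZ : (EuclideanSpace ℝ (Fin 3)))‖ ≤ Cβ := by
      rw [norm_smul, Real.norm_eq_abs]
      have : ‖(eZ : (EuclideanSpace ℝ (Fin 3)))‖ = 1 := by simp [eZ]
      rw [this, mul_one]
      exact hCβ t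
    calc ‖a t x‖ ≤ ‖U t x + β t • eZ‖ + ‖(2 / cylRadius x) • eR x‖ := norm_add_le _ _
      _ ≤ (‖U t x‖ + ‖β t • (eZ : (EuclideanSpace ℝ (Fin 3)))‖) + 2 / ρ := add_le_add (norm_add_le _ _) hE
      _ ≤ C0 + Cβ + 2 / ρ := by linarith [hUbd t ht x]
  have heq : ∀ x, cylRadius x ≠ 0 → ∀ s t : ℝ, s ≤ t → t < 0 →
      f t x - f s x = ∫ τ in s..t, ((Δ (f τ)) x - fderiv ℝ (f τ) x (a τ x)) := by
    intro x hx s t hst ht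
    rw [hf_def]
    simp only
    rw [hswirlEq x hx s t hst ht]
    refine intervalIntegral.integral_congr fun τ _ => ?_
    simp only [ha_def, map_add, map_smul, smul_eq_mul, partialDeriv_apply]
    ring
  -- the `L^p` bound for the representative: `swirl u = swirl U` a.e., for a.e. `t`
  have hswirl_ae : ∀ᵐ t ∂((volume : Measure ℝ).restrict (Iio 0)), swirl (u t) =ᵐ[volume] f t := by
    filter_upwards [hrep] with t ht
    filter_upwards [ht] with x hx
    simp only [hf_def, swirl, hx, PiLp.add_apply, PiLp.smul_apply, eZ, PiLp.single_apply,
      smul_eq_mul]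
    simp only [Fin.isValue, show (1 : Fin 3) ≠ 2 by decide, show (0 : Fin 3) ≠ 2 by decide,
      if_false, mul_zero, add_zero]
  have hLpf : ∀ᵐ t ∂((volume : Measure ℝ).restrict (Iio 0)), eLpNorm (f t) p volume ≤ K := by
    filter_upwards [hswirl_ae, hK] with t ht hKt
    rw [← eLpNorm_congr_ae ht]
    exact hKt
  -- boundedness (Lemma 5.1, Step 1) and the Liouville step (Lemma 5.2)
  obtain ⟨A1, hA1⟩ := hA 1 one_pos
  obtain ⟨C', hC'⟩ := driftHeat_bounded_of_eLpNorm_le (ρ := 1) h0 h1 h2 h3 ha hA1 hp1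
    ENNReal.coe_ne_top hLpf (fun x hx => heq x (by linarith))
  have h5 : ∀ t < 0, ∀ x, |f t x| ≤ max C' (4 * C0) := by
    intro t ht x
    rcases le_or_gt (1 + 3) (cylRadius x) with hx | hx
    · exact (hC' t ht x hx).trans (le_max_left _ _)
    · refine (h4 t ht x).trans ((le_max_right _ _).trans' ?_)
      nlinarith [cylRadius_nonneg x]
  have hzero : ∀ t < 0, ∀ x, f t x = 0 :=
    driftHeat_eq_zero_of_eLpNorm_le h1 h2 h3 h4 h5 ha hA hp0 hpt.ne ENNReal.coe_ne_top hLpf heq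
  -- transfer to `u`
  filter_upwards [hswirl_ae, ae_restrict_mem measurableSet_Iio] with t ht htneg
  filter_upwards [ht] with x hx
  rw [hx]
  exact hzero t htneg x

/-- **Lei–Zhang–Zhao 2017, Theorem 1.3 in the printed class** (arXiv:1701.00868, Thm 1.3 with §5;
for KNSS's bounded weak solutions `u ∈ L^∞(ℝ³ × (−∞, 0))`, axisymmetric a.e., with
`Γ ∈ L^∞_t L^p_x`, `1 ≤ p < ∞`): there is a bounded measurable `b` with `u(t, ·) = b(t) e_z` a.e.,
for a.e. `t < 0` — the swirl vanishes (`leiZhangZhao2017_Lp_ae_swirl_free`) and "according to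
Theorem 5.2 in [KNSS], we have that `v` must be a constant"
(`KNSS2009_liouville_axisymmetric_no_swirl_holds`). [cite: LeiZhangZhao2017, Thm 1.3 and end of §5 (arXiv pp. 4, 12); KochNadirashviliSereginSverak2009, Thm 5.2] -/
theorem leiZhangZhao2017_liouville_swirl_Lp_boundedWeak {u : ℝ → (EuclideanSpace ℝ (Fin 3)) → (EuclideanSpace ℝ (Fin 3))}
    (hu : IsBoundedWeakNSSolutionOn (Iio 0) isOpen_Iio 1 u)
    (haxi : ∀ θ : ℝ, ∀ᵐ t ∂((volume : Measure ℝ).restrict (Iio 0)),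
      (fun x => u t (rotZ θ x)) =ᵐ[volume] fun x => rotZ θ (u t x))
    (hLp : ∃ (p : ℝ≥0∞) (K : ℝ≥0), 1 ≤ p ∧ p < (⊤ : ℝ≥0∞) ∧
      ∀ᵐ t ∂((volume : Measure ℝ).restrict (Iio 0)), eLpNorm (swirl (u t)) p volume ≤ K) :
    ∃ b : ℝ → ℝ, Measurable b ∧ (∃ C : ℝ, ∀ t, |b t| ≤ C) ∧
      ∀ᵐ t ∂((volume : Measure ℝ).restrict (Iio 0)), u t =ᵐ[volume] fun _ => b t • eZ :=
  KNSS2009_liouville_axisymmetric_no_swirl_holds hu haxi (leiZhangZhao2017_Lp_ae_swirl_free hu haxi hLp)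

/-! ### Theorem 1.3 in the duality-form class: the discharge of the named fact -/

/-- **Lei–Zhang–Zhao 2017, Theorem 1.3 (`leiZhangZhao2017_liouville_swirl_Lp`), PROVED.** Every
bounded ancient mild solution of Navier–Stokes (`ν = 1`) on `ℝ³ × (−∞, 0)` in the tree's duality
form, with measurable axisymmetric slices and `sup_{t<0} ‖Γ(t,·)‖_{L^p} < ∞` for some
`1 ≤ p < ∞`, is on every slice a.e. an axial constant `β e_z`. **Proof.** The slice-wise
duality-form class is KNSS's printed class `L^∞(ℝ³ × (−∞, 0))` up to an axial drift (KNSS 2009,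
§1 p. 3): `exists_boundedWeak_axisymmetric_modification` gives a bounded weak solution `v`, a.e.
axisymmetric, with `v(t) = u(t) + d(t) e_z` a.e. for every `t < 0`; its swirl is that of `u`
(`swirl_add_smul_eZ`), so the printed-class theorem
(`leiZhangZhao2017_liouville_swirl_Lp_boundedWeak`) makes `v(t) = b(t) e_z`, hence
`u(t) = (b − d)(t) e_z`, a.e. for a.e. `t`; the continuity of the solenoidal pairings upgrades this
to every `t < 0` (`IsBoundedAncientMildSolution.exists_ae_eq_const_slice`), the constant being
axial (`eq_smul_eZ_of_ae_eq_const_of_isAxisymmetric`). [cite: LeiZhangZhao2017, Thm 1.3 (arXiv p. 4) with Lemmas 5.1–5.2 (pp. 10–12); KochNadirashviliSereginSverak2009, Thm 5.2 and §1 p. 3] -/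
theorem leiZhangZhao2017_liouville_swirl_Lp_holds : leiZhangZhao2017_liouville_swirl_Lp := by
  intro u hu hmeas haxi hLp
  obtain ⟨p, K, hp1, hpt, hK⟩ := hLp
  have hν : (0 : ℝ) < 1 := one_pos
  obtain ⟨v, hweak, hax, hvu⟩ := exists_boundedWeak_axisymmetric_modification hu hmeas haxi
  choose! d hd using hvu
  -- the swirl of `v` has the `L^p` bounds of the swirl of `u`
  have hsw : ∀ᵐ t ∂((volume : Measure ℝ).restrict (Iio 0)),
      eLpNorm (swirl (v t)) p volume ≤ K := by
    filter_upwards [ae_restrict_mem measurableSet_Iio] with t ht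
    have hae : swirl (v t) =ᵐ[volume] swirl (u t) := by
      filter_upwards [hd t ht] with x hx
      have : swirl (v t) x = swirl (fun y => u t y + d t • eZ) x := by
        simp only [swirl, hx]
      rw [this, swirl_add_smul_eZ]
    rw [eLpNorm_congr_ae hae]
    exact hK t ht
  obtain ⟨b, -, -, hb⟩ :=
    leiZhangZhao2017_liouville_swirl_Lp_boundedWeak hweak hax ⟨p, K, hp1, hpt, hsw⟩
  -- the slices of `u` are a.e. constant for a.e. `t`, hence for every `t`
  have hconst : ∀ᵐ t ∂((volume : Measure ℝ).restrict (Iio 0)),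
      u t =ᵐ[volume] fun _ => (b t - d t) • eZ := by
    filter_upwards [hb, ae_restrict_mem measurableSet_Iio] with t hbt ht
    filter_upwards [hbt, hd t ht] with x hx hx'
    have hx2 : v t x = b t • eZ := hx
    have hx3 : v t x = u t x + d t • eZ := hx'
    have e : u t x = v t x - d t • eZ := by rw [hx3, add_sub_cancel_right]
    rw [e, hx2, sub_smul]
  intro t ht
  obtain ⟨κ, hκ⟩ := hu.exists_ae_eq_const_slice hν hmeas hconst t ht
  have hax' := eq_smul_eZ_of_ae_eq_const_of_isAxisymmetric (haxi t ht) hκ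
  refine ⟨κ 2, ?_⟩
  rw [hax'] at hκ
  exact hκ

end Literature.Analysis.FluidPDE

end
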